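import Literature.NumberTheory.LFunctions.StarkNoQuadraticSubfieldGlue
import Literature.NumberTheory.LFunctions.DedekindZetaRealZerosUniform
import Mathlib.FieldTheory.IsAlgClosed.Basic
import HarnessLib

/-!
# Real-zero-free interval for Galois (cyclic) cubic fields

Stub `stub_galoisCubicZeroFree` of line `dedekind-s3-collision` for crux `DegreeOnePrimesEscape`
(stmt-QuantumAdvantage-11543, route LinnikCubicClassGroups): there is an absolute `c > 0` such that
for every Galois (i.e. cyclic) cubic number field `K`, `ζ_K(σ) ≠ 0` for `1 − c/log|d_K| ≤ σ < 1`.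

Proof (route A of the brief, Heilbronn–Stark in the tree). A real zero `σ ∈ (0,1)` of `ζ_K` for
`K/ℚ` Galois of ODD degree is at least a double zero: realise `K` as a normal subfield `N₀` of
`ℚ̄`, let `q : Γ_ℚ → Gal(N₀/ℚ)` be the restriction (an `IsArtinQuotient`,
`StarkNoQuadraticSubfieldGlue` G8); if `ord_σ ζ_K ≤ 1` then Stark's theorem
`Heilbronn.exists_index_two_of_dedekindZetaCont_eq_zero` (with `ζ_ℚ(σ) = ζ(σ) < 0`, so `≠ 0`)
produces a subgroup of index `2` of a group of odd order — absurd. Hence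
`2 ≤ ord_σ ζ₁_K`, and the tree's uniform simplicity theorem
`exists_realZero_simple_dedekindZeta₁ 3` gives `σ ≤ 1 − c₃/(log|d_K| + log 4) < 1 − (c₃/3)/log|d_K|`
since `log 4 < 2 log 3 ≤ 2 log|d_K|` (`|d_K| ≥ 3` by Hermite–Minkowski).
-/

noncomputable section

open scoped NumberField nonZeroDivisors ComplexConjugate
open Literature.NumberTheory.LFunctions Literature.NumberTheory.LFunctions.NumberField
open Literature.NumberTheory.Automorphic Literature.NumberTheory.LFunctions.Heilbronn

namespace Summit.QuantumAdvantage.QuantumAdvantage.Theorems.DegreeOnePrimesEscape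

namespace GaloisCubicZeroFree

/-- **Heilbronn–Stark for a Galois extension of odd degree: a real zero is a multiple zero.**
Let `N₀ ⊆ F̄` be a finite Galois extension of ODD degree of the number field `F`, `K ≅ N₀` a
number field, and `s₀ ≠ 1` a real point with `ζ_F(s₀) ≠ 0` and `ζ_K(s₀) = 0`. Then
`ord_{s₀} ζ_K > 1`: otherwise Stark's theorem (`Heilbronn.exists_index_two_of_dedekindZetaCont_eq_zero`,
applied to the restriction `Γ_F → Gal(N₀/F)` and `H = 1`) gives a subgroup of index `2` of
`Gal(N₀/F)`, a group of odd order. Source: H. M. Stark, Invent. Math. 23 (1974), Thm. 3;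
Murty–Murty, *Non-vanishing of L-functions* (1997), Ch. 2 Cor. 6.2 — both PROVED in the tree
(`HeilbronnStark.lean`); this is their odd-order corollary. -/
theorem one_lt_meromorphicOrderAt_dedekindZetaCont_of_odd {F : Type} [Field F] [NumberField F]
    (N₀ : IntermediateField F (AlgebraicClosure F)) [FiniteDimensional F N₀] [IsGalois F N₀]
    (hodd : Odd (Module.finrank F N₀)) (K : Type) [Field K] [NumberField K] (e : K ≃+* N₀)
    {s₀ : ℂ} (hs₀ : s₀ ≠ 1) (hreal : conj s₀ = s₀) (hbase : dedekindZetaCont F s₀ ≠ 0)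
    (hz : dedekindZetaCont K s₀ = 0) : 1 < meromorphicOrderAt (dedekindZetaCont K) s₀ := by
  classical
  by_contra hord
  rw [not_lt] at hord
  obtain ⟨q, hq_def⟩ : ∃ q : Field.absoluteGaloisGroup F →* (N₀ ≃ₐ[F] N₀),
      q = AlgEquiv.restrictNormalHom N₀ := ⟨_, rfl⟩
  have hq : IsArtinQuotient q := isArtinQuotient_of_eq_restrictNormalHom hq_def
  haveI : NumberField (quotientFixedField q (⊤ : Subgroup (N₀ ≃ₐ[F] N₀))) :=
    numberField_quotientFixedField hq ⊤
  haveI : NumberField (quotientFixedField q (⊥ : Subgroup (N₀ ≃ₐ[F] N₀))) :=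
    numberField_quotientFixedField hq ⊥
  -- the fixed fields of `⊥` and `⊤` are `N₀ ≅ K` and `F`
  have ebot : K ≃+* quotientFixedField q (⊥ : Subgroup (N₀ ≃ₐ[F] N₀)) :=
    e.trans (IntermediateField.equivOfEq
      (quotientFixedField_bot_of_eq_restrictNormalHom hq_def).symm).toRingEquiv
  have etop : quotientFixedField q (⊤ : Subgroup (N₀ ≃ₐ[F] N₀)) ≃+* F :=
    ((IntermediateField.equivOfEq (quotientFixedField_top_eq_bot (q := q))).trans
      (IntermediateField.botEquiv F (AlgebraicClosure F))).toRingEquiv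
  have htop : dedekindZetaCont (quotientFixedField q (⊤ : Subgroup (N₀ ≃ₐ[F] N₀))) s₀ ≠ 0 := by
    rw [dedekindZetaCont_eq_of_ringEquiv etop hs₀]
    exact hbase
  have hH : dedekindZetaCont (quotientFixedField q (⊥ : Subgroup (N₀ ≃ₐ[F] N₀))) s₀ = 0 := by
    rw [← dedekindZetaCont_eq_of_ringEquiv ebot hs₀]
    exact hz
  have hle : artinOrder s₀ ((Representation.leftRegular ℂ (N₀ ≃ₐ[F] N₀)).character ∘ q) ≤ 1 := by
    have h := artinOrder_leftRegular hq s₀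
    rw [← meromorphicOrderAt_dedekindZetaCont_eq_of_ringEquiv ebot hs₀] at h
    have h' : (artinOrder s₀ ((Representation.leftRegular ℂ (N₀ ≃ₐ[F] N₀)).character ∘ q) :
        WithTop ℤ) ≤ (1 : ℤ) := by
      rw [h]; exact_mod_cast hord
    exact_mod_cast h'
  obtain ⟨H₂, -, hH₂⟩ := exists_index_two_of_dedekindZetaCont_eq_zero hq hs₀ hreal hle htop ⊥ hH
  have hdvd : H₂.index ∣ Nat.card (N₀ ≃ₐ[F] N₀) := H₂.index_dvd_card
  rw [hH₂, IsGalois.card_aut_eq_finrank] at hdvd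
  exact (Nat.not_even_iff_odd.mpr hodd) (even_iff_two_dvd.mpr hdvd)

/-- A real `σ < 1` is not the pole: `(σ : ℂ) ≠ 1`. [folklore] -/
theorem ofReal_ne_one_of_lt_one {σ : ℝ} (h1 : σ < 1) : (σ : ℂ) ≠ 1 := by
  intro h
  have h' : σ = 1 := by exact_mod_cast h
  exact h1.ne h'

/-- **A real zero in `(0,1)` of the Dedekind zeta function of a Galois cubic field is at least a
double zero of `ζ₁_K`** (Heilbronn–Stark with `G = C₃`, which has no subgroup of index `2`;
`ζ_ℚ(σ) = ζ(σ) ≠ 0` on `(0,1)`). Source: Stark 1974, Thm. 3 (tree: `HeilbronnStark.lean`). -/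
theorem two_le_analyticOrderAt_dedekindZeta₁_of_isGalois_cubic (K : Type) [Field K] [NumberField K]
    (hK : Module.finrank ℚ K = 3) [IsGalois ℚ K] {σ : ℝ} (h0 : 0 < σ) (h1 : σ < 1)
    (hz : dedekindZetaCont K σ = 0) : (2 : ℕ∞) ≤ analyticOrderAt (dedekindZeta₁ K) σ := by
  classical
  have hσ1 : (σ : ℂ) ≠ 1 := ofReal_ne_one_of_lt_one h1
  rw [analyticOrderAt_dedekindZeta₁_eq_dedekindZetaCont hσ1]
  by_contra hlt
  rw [not_le] at hlt
  have han : AnalyticAt ℂ (dedekindZetaCont K) σ := analyticAt_dedekindZetaCont hσ1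
  -- `ord_σ ζ_K ≤ 1` as a meromorphic order
  have hord : meromorphicOrderAt (dedekindZetaCont K) σ ≤ 1 := by
    rw [han.meromorphicOrderAt_eq]
    have hne : analyticOrderAt (dedekindZetaCont K) σ ≠ ⊤ := by
      intro h; rw [h] at hlt; exact absurd hlt (by decide)
    obtain ⟨m, hm⟩ := ENat.ne_top_iff_exists.mp hne
    rw [← hm] at hlt ⊢
    rw [ENat.map_coe]
    have hm2 : m < 2 := by exact_mod_cast hlt
    have hm1 : (m : ℤ) ≤ 1 := by omega
    exact_mod_cast hm1
  -- realise `K` inside `ℚ̄`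
  set φ : K →ₐ[ℚ] AlgebraicClosure ℚ := IsAlgClosed.lift
  set N₀ : IntermediateField ℚ (AlgebraicClosure ℚ) := φ.fieldRange
  have e : K ≃ₐ[ℚ] N₀ :=
    (IntermediateField.topEquiv.symm.trans ((⊤ : IntermediateField ℚ K).equivMap φ)).trans
      (IntermediateField.equivOfEq (AlgHom.fieldRange_eq_map φ).symm)
  haveI hGal : IsGalois ℚ N₀ := IsGalois.of_algEquiv e
  haveI hFD : FiniteDimensional ℚ N₀ := LinearEquiv.finiteDimensional e.toLinearEquiv
  have hodd : Odd (Module.finrank ℚ N₀) := by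
    rw [← e.toLinearEquiv.finrank_eq, hK]; decide
  have hreal : conj (σ : ℂ) = σ := Complex.conj_ofReal σ
  have hbase : dedekindZetaCont ℚ σ ≠ 0 := by
    rw [dedekindZetaCont_rat_eq_riemannZeta_holds hσ1]
    exact riemannZeta_ofReal_ne_zero_of_pos_of_lt_one σ h0 h1
  -- the instances on `N₀` are passed explicitly (the `ℚ`-algebra structure on `N₀` found by
  -- instance search is `DivisionRing.toRatAlgebra`, defeq but not reducibly to `N₀.algebra`)
  exact (not_lt.mpr hord) (@one_lt_meromorphicOrderAt_dedekindZetaCont_of_odd ℚ _ _ N₀ hFD hGal hodd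
    K _ _ e.toRingEquiv _ hσ1 hreal hbase hz)

/-- `log 3 > 1`. [folklore] -/
theorem one_lt_log_three : 1 < Real.log 3 := by
  rw [← Real.log_exp 1]
  refine Real.log_lt_log (Real.exp_pos 1) ?_
  have := Real.exp_one_lt_d9
  linarith

/-- `|d_K| ≥ 3` as a real number for a number field of degree `> 1` (Hermite–Minkowski,
`NumberField.abs_discr_gt_two`). [folklore] -/
theorem three_le_natAbs_discr (K : Type) [Field K] [NumberField K] (hK : 1 < Module.finrank ℚ K) :
    (3 : ℝ) ≤ ((NumberField.discr K).natAbs : ℝ) := by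
  have h := NumberField.abs_discr_gt_two hK
  have h' : (3 : ℤ) ≤ ((NumberField.discr K).natAbs : ℤ) := by
    rw [Int.natCast_natAbs]; omega
  exact_mod_cast h'

end GaloisCubicZeroFree

open GaloisCubicZeroFree in
/-- **STUB `stub_galoisCubicZeroFree` — real-zero-free interval for Galois (cyclic) cubic fields**:
there is `c > 0` such that for every Galois cubic number field `K` and every real `σ` with
`1 − c/log|d_K| ≤ σ < 1`, `ζ_K(σ) ≠ 0`. With `c₃` the constant of the uniform simplicity theorem
`exists_realZero_simple_dedekindZeta₁ 3`, `c := min (c₃/3) 1` works: a real zero would be a double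
zero of `ζ₁_K` (`two_le_analyticOrderAt_dedekindZeta₁_of_isGalois_cubic`), hence
`σ ≤ 1 − c₃/(log|d_K| + log 4) < 1 − (c₃/3)/log|d_K| ≤ σ`. -/
theorem stub_galoisCubicZeroFree :
    ∃ c : ℝ, 0 < c ∧ ∀ (K : Type) [Field K] [NumberField K], Module.finrank ℚ K = 3 → IsGalois ℚ K →
      ∀ σ : ℝ, 1 - c / Real.log ((NumberField.discr K).natAbs : ℝ) ≤ σ → σ < 1 →
        dedekindZetaCont K σ ≠ 0 := by
  obtain ⟨c₃, hc₃, h₃⟩ := exists_realZero_simple_dedekindZeta₁ 3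
  refine ⟨min (c₃ / 3) 1, lt_min (by positivity) one_pos, fun K _ _ hK hGal σ hσ hσ1 hz => ?_⟩
  haveI := hGal
  set L : ℝ := Real.log ((NumberField.discr K).natAbs : ℝ)
  have hd : (3 : ℝ) ≤ ((NumberField.discr K).natAbs : ℝ) :=
    three_le_natAbs_discr K (by rw [hK]; norm_num)
  have hL3 : Real.log 3 ≤ L := Real.log_le_log (by norm_num) hd
  have hL1 : 1 < L := one_lt_log_three.trans_le hL3
  have hLpos : 0 < L := by linarith
  have hlog4 : Real.log 4 < 2 * L := by
    have h4 : Real.log 4 = 2 * Real.log 2 := by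
      rw [show (4 : ℝ) = 2 ^ 2 by norm_num, Real.log_pow]; norm_num
    have h23 : Real.log 2 < Real.log 3 := Real.log_lt_log two_pos (by norm_num)
    linarith
  have hlog4pos : 0 < Real.log 4 := Real.log_pos (by norm_num)
  -- `σ > 0`
  have hσ0 : 0 < σ := by
    have hc1 : min (c₃ / 3) 1 / L ≤ 1 / L := div_le_div_of_nonneg_right (min_le_right _ _) hLpos.le
    have h1L : 1 / L < 1 := by rw [div_lt_one hLpos]; exact hL1
    linarith
  -- a zero would be a double zero of `ζ₁_K`, pushed away from `1`
  have hord := two_le_analyticOrderAt_dedekindZeta₁_of_isGalois_cubic K hK hσ0 hσ1 hz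
  have hβ : σ ≤ 1 - c₃ / (L + Real.log 4) := h₃ K hK σ hord
  have key : min (c₃ / 3) 1 / L < c₃ / (L + Real.log 4) := by
    have h1 : min (c₃ / 3) 1 / L ≤ (c₃ / 3) / L :=
      div_le_div_of_nonneg_right (min_le_left _ _) hLpos.le
    have h2 : (c₃ / 3) / L < c₃ / (L + Real.log 4) := by
      rw [div_lt_div_iff₀ hLpos (by positivity)]
      have : c₃ / 3 * (L + Real.log 4) < c₃ / 3 * (3 * L) :=
        mul_lt_mul_of_pos_left (by linarith) (by positivity)
      linarith
    exact lt_of_le_of_lt h1 h2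
  linarith

end Summit.QuantumAdvantage.QuantumAdvantage.Theorems.DegreeOnePrimesEscape

end
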